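import Mathlib
import Literature.Geometry.DiscreteGeometry.MultiregularPointSystems
import Summits.AtomisticToContinuum.Crystallization.Theorems.IsometryAtomsAtomicLawChargesCrystalFinitePointGroupA

/-!
# Coaxial collapse, part B: all symmetries preserve the axis of a small rotation

Helper file B for the stub `stub_finitePointGroup` (a Delone set `D ⊆ ℝ³` with finitely many symmetry
orbits has a finite point group) of the line `Sketch` of the crux `IsometryAtoms.AtomicLawChargesCrystal`
(stmt-AtomisticToContinuum-15778).  Throughout, `g₀` is a symmetry of `D` whose linear part
`B₀ = g₀.linearIsometryEquiv` is nontrivial and `1/20`-small (`‖B₀ x - x‖ ≤ ‖x‖ / 20`) with fixed unit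
vector `u` (its axis); the SO(3) facts T2 ("the fixed space of a nontrivial near-identity isometry is its
axis") and Bieberbach's lemma G1a ("`1/10`-small linear parts of symmetries of a Delone set commute") are
explicit hypotheses, exactly as in the registered stub.

* `fpg_conj_lin`, `fpg_conj_small`, `fpg_conj_ne`, `fpg_conj_comm`: the conjugate `g g₀ g⁻¹` has linear
  part `P B₀ P⁻¹`, again nontrivial and `1/20`-small, hence commuting with `B₀` (G1a);
* `fpg_axis_dichotomy` (step B3): every linear part `P` of a symmetry has `P u = u ∨ P u = -u`;
  `fpg_conj_fix`: the linear part of every conjugate of `g₀` fixes `u`;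
* `fpg_transl_on_axis` (step B4): if the point group is infinite, every translation vector of `D` is a
  multiple of `u`;
* `fpg_comm_conj` (step B5): `g₀` commutes with each of its conjugates (the commutator is a translation
  by a vector in `ℝu ∩ u^⊥ = 0`).

No new definitions, no notation; the registered packaging theorem `fpg_subgoalB_conjSmall` closes the file.
-/

namespace Summit.AtomisticToContinuum.Crystallization.Theorems.IsometryAtomsAtomicLawChargesCrystal

open Metric

section Conjugates

variable (g g₀ : EuclideanSpace ℝ (Fin 3) ≃ᵃⁱ[ℝ] EuclideanSpace ℝ (Fin 3))

/-- The linear part of the conjugate `g g₀ g⁻¹` is `P B₀ P⁻¹`. -/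
theorem fpg_conj_lin (x : EuclideanSpace ℝ (Fin 3)) :
    (g * g₀ * g⁻¹).linearIsometryEquiv x =
      g.linearIsometryEquiv (g₀.linearIsometryEquiv (g.linearIsometryEquiv.symm x)) := by
  rw [fpg_lin_mul, fpg_lin_mul, fpg_lin_inv]

/-- Conjugation preserves `ε`-smallness of the linear part. -/
theorem fpg_conj_small {ε : ℝ}
    (hsm : ∀ x : EuclideanSpace ℝ (Fin 3), ‖g₀.linearIsometryEquiv x - x‖ ≤ ε * ‖x‖) :
    ∀ x : EuclideanSpace ℝ (Fin 3), ‖(g * g₀ * g⁻¹).linearIsometryEquiv x - x‖ ≤ ε * ‖x‖ := by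
  intro x
  rw [fpg_conj_lin]
  have hx : g.linearIsometryEquiv (g.linearIsometryEquiv.symm x) = x :=
    LinearIsometryEquiv.apply_symm_apply _ _
  calc ‖g.linearIsometryEquiv (g₀.linearIsometryEquiv (g.linearIsometryEquiv.symm x)) - x‖
      = ‖g.linearIsometryEquiv (g₀.linearIsometryEquiv (g.linearIsometryEquiv.symm x) -
          g.linearIsometryEquiv.symm x)‖ := by
        rw [map_sub, hx]
    _ = ‖g₀.linearIsometryEquiv (g.linearIsometryEquiv.symm x) - g.linearIsometryEquiv.symm x‖ :=
        LinearIsometryEquiv.norm_map _ _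
    _ ≤ ε * ‖g.linearIsometryEquiv.symm x‖ := hsm _
    _ = ε * ‖x‖ := by rw [LinearIsometryEquiv.norm_map]

/-- Conjugation preserves nontriviality of the linear part. -/
theorem fpg_conj_ne (hne : ∃ x : EuclideanSpace ℝ (Fin 3), g₀.linearIsometryEquiv x ≠ x) :
    ∃ x : EuclideanSpace ℝ (Fin 3), (g * g₀ * g⁻¹).linearIsometryEquiv x ≠ x := by
  obtain ⟨x, hx⟩ := hne
  refine ⟨g.linearIsometryEquiv x, ?_⟩
  rw [fpg_conj_lin, LinearIsometryEquiv.symm_apply_apply]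
  exact fun h => hx (g.linearIsometryEquiv.injective h)

end Conjugates

section Axis

variable
  (hT2 : ∀ A : EuclideanSpace ℝ (Fin 3) ≃ₗᵢ[ℝ] EuclideanSpace ℝ (Fin 3),
    (∀ x : EuclideanSpace ℝ (Fin 3), ‖A x - x‖ ≤ ‖x‖ / 2) → ∀ u : EuclideanSpace ℝ (Fin 3), ‖u‖ = 1 →
      A u = u → (∃ x : EuclideanSpace ℝ (Fin 3), A x ≠ x) → ∀ v : EuclideanSpace ℝ (Fin 3), A v = v →
        ∃ c : ℝ, v = c • u)
  (hG1a : ∀ D : Delone.DeloneSet (EuclideanSpace ℝ (Fin 3)),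
    ∀ g₁ g₂ : EuclideanSpace ℝ (Fin 3) ≃ᵃⁱ[ℝ] EuclideanSpace ℝ (Fin 3),
      g₁ '' (D : Set (EuclideanSpace ℝ (Fin 3))) = (D : Set (EuclideanSpace ℝ (Fin 3))) →
      g₂ '' (D : Set (EuclideanSpace ℝ (Fin 3))) = (D : Set (EuclideanSpace ℝ (Fin 3))) →
      (∀ x : EuclideanSpace ℝ (Fin 3), ‖g₁.linear x - x‖ ≤ ‖x‖ / 10) →
      (∀ x : EuclideanSpace ℝ (Fin 3), ‖g₂.linear x - x‖ ≤ ‖x‖ / 10) →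
        ∀ x : EuclideanSpace ℝ (Fin 3), g₁.linear (g₂.linear x) = g₂.linear (g₁.linear x))
  {D : Delone.DeloneSet (EuclideanSpace ℝ (Fin 3))}
  {g₀ : EuclideanSpace ℝ (Fin 3) ≃ᵃⁱ[ℝ] EuclideanSpace ℝ (Fin 3)}
  (hg₀ : g₀ '' (D : Set (EuclideanSpace ℝ (Fin 3))) = (D : Set (EuclideanSpace ℝ (Fin 3))))
  (hsm₀ : ∀ x : EuclideanSpace ℝ (Fin 3), ‖g₀.linearIsometryEquiv x - x‖ ≤ 1 / 20 * ‖x‖)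

include hG1a hg₀ hsm₀ in
/-- **Bieberbach's lemma applied to `g₀` and a conjugate**: `B₀` commutes with `P B₀ P⁻¹` for the
linear part `P` of any symmetry `g` of `D`. -/
theorem fpg_conj_comm {g : EuclideanSpace ℝ (Fin 3) ≃ᵃⁱ[ℝ] EuclideanSpace ℝ (Fin 3)}
    (hg : g '' (D : Set (EuclideanSpace ℝ (Fin 3))) = (D : Set (EuclideanSpace ℝ (Fin 3)))) :
    ∀ x : EuclideanSpace ℝ (Fin 3),
      g₀.linearIsometryEquiv ((g * g₀ * g⁻¹).linearIsometryEquiv x) =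
        (g * g₀ * g⁻¹).linearIsometryEquiv (g₀.linearIsometryEquiv x) := by
  have hD' : (g * g₀ * g⁻¹) '' (D : Set (EuclideanSpace ℝ (Fin 3))) =
      (D : Set (EuclideanSpace ℝ (Fin 3))) :=
    fpg_sym_mul _ _ (fpg_sym_mul _ _ hg hg₀) (fpg_sym_inv _ hg)
  have h1 : ∀ x : EuclideanSpace ℝ (Fin 3), ‖g₀.linear x - x‖ ≤ ‖x‖ / 10 := fun x => by
    rw [fpg_linear_apply]
    exact fpg_small_tenth (by norm_num) hsm₀ x
  have h2 : ∀ x : EuclideanSpace ℝ (Fin 3), ‖(g * g₀ * g⁻¹).linear x - x‖ ≤ ‖x‖ / 10 := fun x => by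
    rw [fpg_linear_apply]
    exact fpg_small_tenth (by norm_num) (fpg_conj_small g g₀ hsm₀) x
  intro x
  have h3 := hG1a D g₀ (g * g₀ * g⁻¹) hg₀ hD' h1 h2 x
  simpa only [fpg_linear_apply] using h3

variable (hne₀ : ∃ x : EuclideanSpace ℝ (Fin 3), g₀.linearIsometryEquiv x ≠ x)
  {u : EuclideanSpace ℝ (Fin 3)} (hu : ‖u‖ = 1) (hu₀ : g₀.linearIsometryEquiv u = u)

include hT2 hG1a hg₀ hsm₀ hne₀ hu hu₀

/-- **Step B3 (axis dichotomy).** The linear part `P` of every symmetry of `D` maps the axis `u` of `B₀`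
to `± u`: `Q = P B₀ P⁻¹` is small, nontrivial and commutes with `B₀` (G1a), so `P u` and `B₀ (P u)` are
both `Q`-fixed, whence `B₀ (P u) ∈ ℝ (P u)` (T2), `B₀ (P u) = P u` (smallness), `P u ∈ ℝ u` (T2). -/
theorem fpg_axis_dichotomy {g : EuclideanSpace ℝ (Fin 3) ≃ᵃⁱ[ℝ] EuclideanSpace ℝ (Fin 3)}
    (hg : g '' (D : Set (EuclideanSpace ℝ (Fin 3))) = (D : Set (EuclideanSpace ℝ (Fin 3)))) :
    g.linearIsometryEquiv u = u ∨ g.linearIsometryEquiv u = -u := by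
  have hQhalf := fpg_small_half (by norm_num) (fpg_conj_small g g₀ hsm₀)
  have hcomm := fpg_conj_comm hG1a hg₀ hsm₀ hg
  obtain ⟨x₀, hx₀⟩ := fpg_conj_ne g g₀ hne₀
  have hBhalf := fpg_small_half (by norm_num) hsm₀
  have h1 : (g * g₀ * g⁻¹).linearIsometryEquiv (g.linearIsometryEquiv u) = g.linearIsometryEquiv u := by
    rw [fpg_conj_lin, LinearIsometryEquiv.symm_apply_apply, hu₀]
  have h2 : (g * g₀ * g⁻¹).linearIsometryEquiv (g₀.linearIsometryEquiv (g.linearIsometryEquiv u)) =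
      g₀.linearIsometryEquiv (g.linearIsometryEquiv u) := by
    rw [← hcomm, h1]
  have hPu : ‖g.linearIsometryEquiv u‖ = 1 := by rw [LinearIsometryEquiv.norm_map, hu]
  obtain ⟨c, hc⟩ := hT2 _ hQhalf _ hPu h1 ⟨x₀, hx₀⟩ _ h2
  have h3 : g₀.linearIsometryEquiv (g.linearIsometryEquiv u) = g.linearIsometryEquiv u :=
    fpg_fixed_of_smul _ hBhalf hc
  obtain ⟨c', hc'⟩ := hT2 _ hBhalf u hu hu₀ hne₀ _ h3
  have hc'' : c' = 1 ∨ c' = -1 := fpg_unit_smul hu (by rw [← hc']; exact hPu)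
  rcases hc'' with rfl | rfl
  · left
    rw [hc', one_smul]
  · right
    rw [hc', neg_one_smul]

/-- The linear part `P B₀ P⁻¹` of every conjugate `g g₀ g⁻¹` of `g₀` by a symmetry fixes the axis `u`. -/
theorem fpg_conj_fix {g : EuclideanSpace ℝ (Fin 3) ≃ᵃⁱ[ℝ] EuclideanSpace ℝ (Fin 3)}
    (hg : g '' (D : Set (EuclideanSpace ℝ (Fin 3))) = (D : Set (EuclideanSpace ℝ (Fin 3)))) :
    (g * g₀ * g⁻¹).linearIsometryEquiv u = u := by
  rw [fpg_conj_lin]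
  rcases fpg_axis_dichotomy hT2 hG1a hg₀ hsm₀ hne₀ hu hu₀ hg with h | h
  · have hs : g.linearIsometryEquiv.symm u = u :=
      g.linearIsometryEquiv.injective (by rw [LinearIsometryEquiv.apply_symm_apply, h])
    rw [hs, hu₀, h]
  · have hs : g.linearIsometryEquiv.symm u = -u :=
      g.linearIsometryEquiv.injective (by rw [LinearIsometryEquiv.apply_symm_apply, map_neg, h, neg_neg])
    rw [hs, map_neg, hu₀, map_neg, h, neg_neg]

variable
  (hT0 : ∀ S : Set (EuclideanSpace ℝ (Fin 3) ≃ₗᵢ[ℝ] EuclideanSpace ℝ (Fin 3)), S.Infinite → ∀ ε : ℝ,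
    0 < ε → ∃ A ∈ S, ∃ B ∈ S, A ≠ B ∧ ∀ x : EuclideanSpace ℝ (Fin 3), ‖A x - B x‖ ≤ ε * ‖x‖)
  (hinf : {A : EuclideanSpace ℝ (Fin 3) ≃ₗᵢ[ℝ] EuclideanSpace ℝ (Fin 3) |
      ∃ g : EuclideanSpace ℝ (Fin 3) ≃ᵃⁱ[ℝ] EuclideanSpace ℝ (Fin 3),
        g '' (D : Set (EuclideanSpace ℝ (Fin 3))) = (D : Set (EuclideanSpace ℝ (Fin 3))) ∧
          g.linearIsometryEquiv = A}.Infinite)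

include hT0 hinf

/-- **Step B4 (translations lie on the axis).** If the point group is infinite, every translation vector
`v` of `D` is a multiple of `u`: an `ε`-small nontrivial linear part `B` of a symmetry (`ε ≤ 1/20`,
`ε ‖v‖ ≤ packingRadius`) fixes `u` (dichotomy + smallness), `B v - v` is a translation vector shorter than
the packing radius, hence `0`, and the fixed space of `B` is `ℝ u` (T2). -/
theorem fpg_transl_on_axis {v : EuclideanSpace ℝ (Fin 3)}
    (hv : ∀ x : EuclideanSpace ℝ (Fin 3),
      x ∈ (D : Set (EuclideanSpace ℝ (Fin 3))) ↔ x + v ∈ (D : Set (EuclideanSpace ℝ (Fin 3)))) :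
    ∃ c : ℝ, v = c • u := by
  by_cases hv0 : v = 0
  · exact ⟨0, by rw [hv0, zero_smul]⟩
  have hvn : 0 < ‖v‖ := norm_pos_iff.mpr hv0
  have hρ : (0 : ℝ) < D.packingRadius := NNReal.coe_pos.mpr D.packingRadius_pos
  obtain ⟨g, hg, hne, hsm⟩ :=
    fpg_exists_small hT0 hinf (lt_min (by norm_num : (0 : ℝ) < 1 / 20) (div_pos hρ hvn))
  have hsm20 : ∀ x : EuclideanSpace ℝ (Fin 3), ‖g.linearIsometryEquiv x - x‖ ≤ 1 / 20 * ‖x‖ :=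
    fun x => (hsm x).trans (mul_le_mul_of_nonneg_right (min_le_left _ _) (norm_nonneg _))
  have hhalf := fpg_small_half (by norm_num) hsm20
  have hgu : g.linearIsometryEquiv u = u := by
    rcases fpg_axis_dichotomy hT2 hG1a hg₀ hsm₀ hne₀ hu hu₀ hg with h | h
    · exact h
    · exfalso
      have h1 := hhalf u
      rw [h, hu] at h1
      have h2 : ‖-u - u‖ = 2 := by
        rw [show -u - u = (-2 : ℝ) • u by module, norm_smul, hu, Real.norm_eq_abs, abs_neg, abs_two,
          mul_one]
      linarith
  have hv2 := fpg_transl_add (fpg_transl_conj g hg hv) (fpg_transl_neg hv)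
  have hsmallv : ‖g.linearIsometryEquiv v + -v‖ ≤ D.packingRadius := by
    rw [← sub_eq_add_neg]
    calc ‖g.linearIsometryEquiv v - v‖ ≤ min (1 / 20) (↑D.packingRadius / ‖v‖) * ‖v‖ := hsm v
      _ ≤ ↑D.packingRadius / ‖v‖ * ‖v‖ :=
          mul_le_mul_of_nonneg_right (min_le_right _ _) (norm_nonneg _)
      _ = D.packingRadius := div_mul_cancel₀ _ hvn.ne'
  have h0 := fpg_transl_eq_zero D hv2 hsmallv
  have hfix : g.linearIsometryEquiv v = v := by
    rwa [← sub_eq_add_neg, sub_eq_zero] at h0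
  exact hT2 _ hhalf u hu hgu hne v hfix

/-- **Step B5 (`g₀` commutes with its conjugates).** For a symmetry `g` of `D` and `h := g g₀ g⁻¹`, the
commutator `k := g₀ h g₀⁻¹ h⁻¹` has trivial linear part (the linear parts commute by G1a), so it is the
translation by `w = k x - x = g₀ (h 0) - h (g₀ 0) = (B₀ s - s) + (t - Q t)` (`s = h 0`, `t = g₀ 0`,
`Q` the linear part of `h`, `Q u = u`), a translation vector of `D`, hence in `ℝ u` (B4), and orthogonal
to `u`; so `w = 0`, `k = 1`. -/
theorem fpg_comm_conj {g : EuclideanSpace ℝ (Fin 3) ≃ᵃⁱ[ℝ] EuclideanSpace ℝ (Fin 3)}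
    (hg : g '' (D : Set (EuclideanSpace ℝ (Fin 3))) = (D : Set (EuclideanSpace ℝ (Fin 3)))) :
    g₀ * (g * g₀ * g⁻¹) = g * g₀ * g⁻¹ * g₀ := by
  have hhD : (g * g₀ * g⁻¹) '' (D : Set (EuclideanSpace ℝ (Fin 3))) =
      (D : Set (EuclideanSpace ℝ (Fin 3))) :=
    fpg_sym_mul _ _ (fpg_sym_mul _ _ hg hg₀) (fpg_sym_inv _ hg)
  have hQu : (g * g₀ * g⁻¹).linearIsometryEquiv u = u := fpg_conj_fix hT2 hG1a hg₀ hsm₀ hne₀ hu hu₀ hg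
  have hcomm := fpg_conj_comm hG1a hg₀ hsm₀ hg
  set h := g * g₀ * g⁻¹ with hh
  set k := g₀ * h * g₀⁻¹ * h⁻¹ with hk
  have hkD : k '' (D : Set (EuclideanSpace ℝ (Fin 3))) = (D : Set (EuclideanSpace ℝ (Fin 3))) :=
    fpg_sym_mul _ _ (fpg_sym_mul _ _ (fpg_sym_mul _ _ hg₀ hhD) (fpg_sym_inv _ hg₀)) (fpg_sym_inv _ hhD)
  have hklin : ∀ v : EuclideanSpace ℝ (Fin 3), k.linearIsometryEquiv v = v := by
    intro v
    rw [hk, fpg_lin_mul, fpg_lin_mul, fpg_lin_mul, fpg_lin_inv, fpg_lin_inv, hcomm,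
      LinearIsometryEquiv.apply_symm_apply, LinearIsometryEquiv.apply_symm_apply]
  have hwT := fpg_transl_of_lin_id k hkD hklin 0
  obtain ⟨c, hc⟩ := fpg_transl_on_axis hT2 hG1a hg₀ hsm₀ hne₀ hu hu₀ hT0 hinf hwT
  have hkx : k (h (g₀ 0)) = g₀ (h 0) := by
    rw [hk]
    simp
  have hw : k 0 - 0 = g₀ (h 0) - h (g₀ 0) := by
    have e := fpg_eq_add_of_lin_id k hklin 0 (h (g₀ 0))
    rw [← hkx, e]
    abel
  have hinner : inner ℝ (k 0 - 0) u = 0 := by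
    rw [hw, fpg_apply_eq g₀ (h 0) 0, fpg_apply_eq h (g₀ 0) 0]
    have e : g₀.linearIsometryEquiv (h 0 - 0) + g₀ 0 - (h.linearIsometryEquiv (g₀ 0 - 0) + h 0) =
        (g₀.linearIsometryEquiv (h 0 - 0) - (h 0 - 0)) -
          (h.linearIsometryEquiv (g₀ 0 - 0) - (g₀ 0 - 0)) := by abel
    rw [e, inner_sub_left, fpg_inner_sub_fixed _ hu₀, fpg_inner_sub_fixed _ hQu, sub_zero]
  have hc0 : c = 0 := fpg_smul_coeff_eq_zero hu (by rw [← hc]; exact hinner)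
  have hw0 : k 0 - 0 = 0 := by rw [hc, hc0, zero_smul]
  have hk1 : k = 1 := by
    refine AffineIsometryEquiv.ext fun x => ?_
    rw [fpg_eq_add_of_lin_id k hklin 0 x, hw0, add_zero, AffineIsometryEquiv.coe_one, id]
  calc g₀ * h = k * (h * g₀) := by rw [hk]; group
    _ = h * g₀ := by rw [hk1, one_mul]

end Axis

/-- **Registered sub-goal (helper file B) of `stub_finitePointGroup`: conjugation preserves smallness of
the linear part.** -/
theorem fpg_subgoalB_conjSmall : ∀ (g g₀ : EuclideanSpace ℝ (Fin 3) ≃ᵃⁱ[ℝ] EuclideanSpace ℝ (Fin 3)) (ε : ℝ), (∀ x : EuclideanSpace ℝ (Fin 3), ‖g₀.linearIsometryEquiv x - x‖ ≤ ε * ‖x‖) → ∀ x : EuclideanSpace ℝ (Fin 3), ‖(g * g₀ * g⁻¹).linearIsometryEquiv x - x‖ ≤ ε * ‖x‖ :=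
  fun g g₀ _ hsm => fpg_conj_small g g₀ hsm

end Summit.AtomisticToContinuum.Crystallization.Theorems.IsometryAtomsAtomicLawChargesCrystal
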